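import Summits.CriticalPhenomena.SAWScalingLimit.Theorems.SAWCompassLatticeCompassSLEYbSubseqLimitChordal
import Summits.CriticalPhenomena.SAWScalingLimit.Theorems.SAWDevelopingMapHexTransferGMHexDictionaryCurves
import Literature.Probability.RandomPlanarGeometry.YangBaxterSAWTwoPoint
import Mathlib.Probability.ConditionalProbability
import Mathlib.Topology.MetricSpace.Thickening

/-!
# The exact domain-restriction property of Glazman–Manolescu's Yang–Baxter walk, and the
# partition-function sandwich for the hull-avoidance probabilities of stub I1
# (crux `CompassSLE`, stmt-CriticalPhenomena-6965, line `registered` = `birth`, lead c6)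

The open stub I1 `stub_ybRestrictionLaw` of `Cruxes/CompassSLE/Lines/birth.lean` (the
Lawler–Schramm–Werner `5/8` restriction law for GM's critical `π/2` walk) speaks of the lattice
probabilities `P^{YB}_{Ω,δ}(range γ ⊆ closure Ω')` for sub-domains `Ω' ⊆ Ω`. Its docstring records the
lattice mechanism that makes this a statement about PARTITION FUNCTIONS: the GM weight of a walk is
a product of local face weights and does not depend on the ambient domain, so the law has the exact
domain-restriction (domain-Markov) property. This file proves that mechanism, for every angle
sequence `Θ`, fugacity `x` and mesh `δ`, with no hypothesis on the domains beyond `Ω' ⊆ Ω`: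

* `range_mapDomain_meshFaces` — the walks of `Ω_δ` all of whose rhombi lie in `Ω'_δ` are exactly
  the (injective) image of the walks of `Ω'_δ`;
* `ybWeight_setOf_facesVisited`, `map_mapDomain_ybWeight` — the weight measure of `Ω'_δ` is the
  restriction of the weight measure of `Ω_δ` to that event; in particular its mass is `Z(Ω'_δ)`;
* `ybLaw_setOf_facesVisited` — **restriction formula** `P_{Ω,δ}(γ ⊆ Ω'_δ) = Z(Ω'_δ; a, b) / Z(Ω_δ; a, b)`
  (`= G_{Ω'_δ}(a,b) / G_{Ω_δ}(a,b)` at `x = 1`, `ybLaw_setOf_facesVisited_one`);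
* `map_mapDomain_ybLaw` — **domain-Markov property**: the law of `Ω'_δ` is the law of `Ω_δ`
  conditioned on `{γ ⊆ Ω'_δ}` (`ProbabilityTheory.cond`), whenever the two partition functions are
  non-degenerate;
* `div_le_ybLaw_preimage_rangeSubset`, `ybLaw_preimage_rangeSubset_le_div` and their pushed-forward
  forms — **the sandwich** for the curve event of stub I1: for `a ≠ b` and `Ω' ⊆ Ω`,
  `Z(Ω'_δ)/Z(Ω_δ) ≤ P_{Ω,δ}(range ⊆ Ω') ≤ P_{Ω,δ}(range ⊆ closure Ω')`, and for every `Ω''` and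
  `δ ≥ 0`, `P_{Ω,δ}(range ⊆ Ω'') ≤ Z((Ω ∩ cthickening (2δ) Ω'')_δ)/Z(Ω_δ)` (a rhombus of unit side
  has diameter `≤ 2` — `Cruxes.HexTransfer.YbRelay.dist_le_two_of_mem_rhombus`, landed — and a visited
  rhombus contains a vertex of the drawn polyline), so that I1 is its partition-function form up to
  a `2δ`-thickening of the sub-domain.

All statements are [folklore] bookkeeping on the tree's definitions (`YangBaxterSAW.lean`,
`YangBaxterSAWLaw.lean`, `YangBaxterSAWTwoPoint.lean`); they are the lattice input of any proof or
refutation of I1 and of the sibling stub `stub_avoidanceCocycleLimit` of crux `YBLimitExists`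
(stmt-CriticalPhenomena-16995). Reference for the restriction property of self-avoiding-walk-type
laws: G. F. Lawler, O. Schramm, W. Werner, *On the scaling limit of planar self-avoiding walk*,
Proc. Sympos. Pure Math. 72 (2004), §1 (the discrete restriction property).
-/

noncomputable section

namespace Summit.CriticalPhenomena.SAWScalingLimit.Theorems.SAWCompassLatticeCompassSLE

open MeasureTheory Filter Topology Set Metric
open scoped NNReal ENNReal
open Literature.Probability.LatticeModels (polyline mem_range_polyline)
open Literature.Probability.RandomPlanarGeometry
open Literature.Probability.RandomPlanarGeometry.SAW.YangBaxter

variable {Θ : ℤ → ℝ} {Ω Ω' : Set ℂ} {δ : ℝ} {a b : MidEdge}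

/-! ### The event "the walk uses only rhombi of `Ω'_δ`" -/

/-- Enlarging the ambient domain does not change the rhombi visited by a walk. [folklore] -/
theorem facesVisited_mapDomain {D D' : Set Face} (h : D ⊆ D') (γ : YBWalk D a b) :
    (γ.mapDomain h).facesVisited = γ.facesVisited := rfl

/-- Enlarging the ambient domain does not change the length of a walk. [folklore] -/
theorem length_mapDomain {D D' : Set Face} (h : D ⊆ D') (Θ : ℤ → ℝ) (γ : YBWalk D a b) :
    (γ.mapDomain h).length Θ = γ.length Θ := rfl

/-- Enlarging the ambient domain does not change the drawn polyline. [folklore] -/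
theorem path_mapDomain {D D' : Set Face} (h : D ⊆ D') (Θ : ℤ → ℝ) (δ : ℝ) (γ : YBWalk D a b) :
    (γ.mapDomain h).path Θ δ = γ.path Θ δ := rfl

/-- Enlarging the ambient domain does not change the curve class. [folklore] -/
theorem curve_mapDomain {D D' : Set Face} (h : D ⊆ D') (Θ : ℤ → ℝ) (δ : ℝ) (γ : YBWalk D a b) :
    (γ.mapDomain h).curve Θ δ = γ.curve Θ δ := rfl

/-- **The walks of `Ω_δ` using only rhombi of `Ω'_δ` are exactly the walks of `Ω'_δ`** (image of
the injection `YBWalk.mapDomain`). [folklore] -/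
theorem range_mapDomain_meshFaces (h : Ω' ⊆ Ω) :
    Set.range (YBWalk.mapDomain (a := a) (z := b) (meshFaces_mono Θ h δ)) =
      {γ : YangBaxterSAW Θ Ω δ a b | ∀ f ∈ γ.facesVisited, f ∈ meshFaces Θ Ω' δ} := by
  ext γ
  constructor
  · rintro ⟨γ', rfl⟩ f hf
    exact γ'.mem_of_mem_facesVisited hf
  · intro hγ
    exact ⟨γ.restrict _ hγ, rfl⟩

/-! ### Weights: the weight measure of `Ω'_δ` is a restriction of that of `Ω_δ` -/

/-- The weight measure evaluated on a set of walks is the sum of the weights of its elements.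
[cite: GlazmanManolescu2019, §1, eq. (4)] -/
theorem ybWeight_apply (Θ : ℤ → ℝ) (Ω : Set ℂ) (δ x : ℝ) (a b : MidEdge)
    (S : Set (YangBaxterSAW Θ Ω δ a b)) :
    ybWeight Θ Ω δ x a b S =
      ∑' γ, S.indicator (fun γ => ENNReal.ofReal (γ.weight Θ * x ^ (γ.length Θ))) γ := by
  rw [ybWeight, Measure.sum_apply _ MeasurableSpace.measurableSet_top]
  refine tsum_congr fun γ => ?_
  rw [Measure.smul_apply, smul_eq_mul, Measure.dirac_apply' _ MeasurableSpace.measurableSet_top]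
  by_cases hγ : γ ∈ S
  · simp [hγ]
  · simp [hγ]

/-- **The total weight of the walks of `Ω_δ` staying in `Ω'_δ` is the partition function of
`Ω'_δ`.** [folklore] -/
theorem ybWeight_setOf_facesVisited (h : Ω' ⊆ Ω) (x : ℝ) :
    ybWeight Θ Ω δ x a b {γ | ∀ f ∈ γ.facesVisited, f ∈ meshFaces Θ Ω' δ} =
      ybWeight Θ Ω' δ x a b Set.univ := by
  rw [ybWeight_apply, ← range_mapDomain_meshFaces h, ← tsum_subtype,
    tsum_range (fun γ : YangBaxterSAW Θ Ω δ a b => ENNReal.ofReal (γ.weight Θ * x ^ (γ.length Θ)))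
      (YBWalk.mapDomain_injective _), ybWeight_univ]
  rfl

/-- At `x = 1`: the weight of `{γ ⊆ Ω'_δ}` under the weight measure of `Ω_δ` is the two-point
function `G_{Ω'_δ}(a, b)`. [folklore] -/
theorem ybWeight_setOf_facesVisited_one (h : Ω' ⊆ Ω) :
    ybWeight Θ Ω δ 1 a b {γ | ∀ f ∈ γ.facesVisited, f ∈ meshFaces Θ Ω' δ} =
      twoPoint (meshFaces Θ Ω' δ) Θ a b := by
  rw [ybWeight_setOf_facesVisited h, ybWeight_univ_one]

/-- **The weight measure of `Ω'_δ`, pushed into the walks of `Ω_δ`, is the restriction of the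
weight measure of `Ω_δ` to `{γ ⊆ Ω'_δ}`** (the weight of a walk does not depend on the ambient
domain). [folklore] -/
theorem map_mapDomain_ybWeight (h : Ω' ⊆ Ω) (x : ℝ) :
    (ybWeight Θ Ω' δ x a b).map (YBWalk.mapDomain (meshFaces_mono Θ h δ)) =
      (ybWeight Θ Ω δ x a b).restrict {γ | ∀ f ∈ γ.facesVisited, f ∈ meshFaces Θ Ω' δ} := by
  ext T hT
  rw [Measure.map_apply (YBWalk.measurable_of_top _) hT, Measure.restrict_apply hT,
    ybWeight_apply, ybWeight_apply]
  conv_rhs =>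
    rw [Set.inter_comm, ← range_mapDomain_meshFaces h, ← Set.indicator_indicator, ← tsum_subtype,
      tsum_range (T.indicator fun γ : YangBaxterSAW Θ Ω δ a b =>
        ENNReal.ofReal (γ.weight Θ * x ^ (γ.length Θ))) (YBWalk.mapDomain_injective _)]
  refine tsum_congr fun γ' => ?_
  rfl

/-! ### The law: restriction formula and domain-Markov property -/

/-- **Restriction formula.** The probability, under the Yang–Baxter law of `Ω_δ`, that the walk
uses only rhombi of `Ω'_δ` (`Ω' ⊆ Ω`) is the ratio of partition functions
`Z(Ω'_δ; a, b) / Z(Ω_δ; a, b)` (with the `ℝ≥0∞` conventions of `ybLaw`: `0` if `Z(Ω_δ) ∈ {0, ∞}`).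
[folklore] -/
theorem ybLaw_setOf_facesVisited (h : Ω' ⊆ Ω) (x : ℝ) :
    ybLaw Θ Ω δ x a b {γ | ∀ f ∈ γ.facesVisited, f ∈ meshFaces Θ Ω' δ} =
      ybWeight Θ Ω' δ x a b Set.univ / ybWeight Θ Ω δ x a b Set.univ := by
  rw [ybLaw, Measure.smul_apply, smul_eq_mul, ybWeight_setOf_facesVisited h,
    ENNReal.div_eq_inv_mul]

/-- Restriction formula at `x = 1`, in terms of the two-point functions of `YangBaxterSAW.lean`:
`P_{Ω,δ}(γ ⊆ Ω'_δ) = G_{Ω'_δ}(a, b) / G_{Ω_δ}(a, b)`. [folklore] -/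
theorem ybLaw_setOf_facesVisited_one (h : Ω' ⊆ Ω) :
    ybLaw Θ Ω δ 1 a b {γ | ∀ f ∈ γ.facesVisited, f ∈ meshFaces Θ Ω' δ} =
      twoPoint (meshFaces Θ Ω' δ) Θ a b / twoPoint (meshFaces Θ Ω δ) Θ a b := by
  rw [ybLaw_setOf_facesVisited h, ybWeight_univ_one, ybWeight_univ_one]

/-- The partition function is monotone in the domain. [folklore] -/
theorem ybWeight_univ_mono (h : Ω' ⊆ Ω) (x : ℝ) :
    ybWeight Θ Ω' δ x a b Set.univ ≤ ybWeight Θ Ω δ x a b Set.univ := by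
  rw [← ybWeight_setOf_facesVisited h]
  exact measure_mono (Set.subset_univ _)

/-- **Domain-Markov (restriction) property of the Yang–Baxter law.** If `Z(Ω'_δ; a, b) ≠ 0` and
`Z(Ω_δ; a, b) ≠ ∞` (both automatic for a bounded domain, positive mesh, angles in `[π/3, 2π/3]` and
a walk of `Ω'_δ` from `a` to `b`), the law of the walk in `Ω'_δ` is the law of the walk in `Ω_δ`
CONDITIONED on using only rhombi of `Ω'_δ`.
[cite: LawlerSchrammWerner2004SAW, §1 (restriction property of SAW)] -/
theorem map_mapDomain_ybLaw (h : Ω' ⊆ Ω) (x : ℝ)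
    (h0 : ybWeight Θ Ω' δ x a b Set.univ ≠ 0) (htop : ybWeight Θ Ω δ x a b Set.univ ≠ ⊤) :
    (ybLaw Θ Ω' δ x a b).map (YBWalk.mapDomain (meshFaces_mono Θ h δ)) =
      ProbabilityTheory.cond (ybLaw Θ Ω δ x a b)
        {γ | ∀ f ∈ γ.facesVisited, f ∈ meshFaces Θ Ω' δ} := by
  have hZ0 : ybWeight Θ Ω δ x a b Set.univ ≠ 0 :=
    fun h' => h0 (nonpos_iff_eq_zero.1 ((ybWeight_univ_mono h x).trans h'.le))
  have hZ'top : ybWeight Θ Ω' δ x a b Set.univ ≠ ⊤ :=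
    ne_top_of_le_ne_top htop (ybWeight_univ_mono h x)
  rw [ProbabilityTheory.cond, ybLaw_setOf_facesVisited h, ybLaw, ybLaw, Measure.map_smul,
    Measure.restrict_smul, map_mapDomain_ybWeight h, smul_smul]
  congr 1
  rw [ENNReal.inv_div (Or.inr hZ'top) (Or.inr h0), ENNReal.div_eq_inv_mul, mul_comm,
    ← mul_assoc, mul_right_comm, ENNReal.inv_mul_cancel hZ0 htop, one_mul]

/-! ### The curve event of stub I1: the partition-function sandwich -/

/-- A walk of `Ω_δ` that uses only rhombi of `Ω'_δ` and has an arc (`a ≠ b`) is drawn inside `Ω'`.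
[folklore] -/
theorem range_path_subset_of_facesVisited (γ : YangBaxterSAW Θ Ω δ a b)
    (hγ : ∀ f ∈ γ.facesVisited, f ∈ meshFaces Θ Ω' δ) (hab : a ≠ b) :
    Set.range (γ.path Θ δ) ⊆ Ω' :=
  range_path_subset_of_ne (γ.restrict (meshFaces Θ Ω' δ) hγ) hab

/-- For `a ≠ b`, `{γ ⊆ Ω'_δ} ⊆ {range of the drawn walk ⊆ Ω'}`. [folklore] -/
theorem setOf_facesVisited_subset_preimage_rangeSubset (hab : a ≠ b) (Ω' : Set ℂ) :
    {γ : YangBaxterSAW Θ Ω δ a b | ∀ f ∈ γ.facesVisited, f ∈ meshFaces Θ Ω' δ} ⊆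
      (fun γ => γ.curve Θ δ) ⁻¹' CurveClass.rangeSubset Ω' := by
  intro γ hγ
  simp only [Set.mem_preimage, YBWalk.curve, CurveClass.mk_mem_rangeSubset]
  exact fun t => range_path_subset_of_facesVisited γ hγ hab ⟨t, rfl⟩

/-- **Lower half of the sandwich.** For `Ω' ⊆ Ω` and `a ≠ b`,
`Z(Ω'_δ; a, b) / Z(Ω_δ; a, b) ≤ P_{Ω,δ}(range ⊆ Ω')`. [folklore] -/
theorem div_le_ybLaw_preimage_rangeSubset (h : Ω' ⊆ Ω) (hab : a ≠ b) (x : ℝ) :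
    ybWeight Θ Ω' δ x a b Set.univ / ybWeight Θ Ω δ x a b Set.univ ≤
      ybLaw Θ Ω δ x a b ((fun γ => γ.curve Θ δ) ⁻¹' CurveClass.rangeSubset Ω') := by
  rw [← ybLaw_setOf_facesVisited h x]
  exact measure_mono (setOf_facesVisited_subset_preimage_rangeSubset hab Ω')

/-- Lower half of the sandwich for the PUSHED-FORWARD law and the CLOSED event of stub I1:
`Z(Ω'_δ)/Z(Ω_δ) ≤ (P_{Ω,δ} ∘ curve⁻¹)(range ⊆ closure Ω')`. [folklore] -/
theorem div_le_map_ybLaw_rangeSubset_closure (h : Ω' ⊆ Ω) (hab : a ≠ b) (x : ℝ) :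
    ybWeight Θ Ω' δ x a b Set.univ / ybWeight Θ Ω δ x a b Set.univ ≤
      (ybLaw Θ Ω δ x a b).map (fun γ => γ.curve Θ δ)
        (CurveClass.rangeSubset (closure Ω')) := by
  refine (div_le_ybLaw_preimage_rangeSubset h hab x).trans ?_
  refine (measure_mono ?_).trans
    (Measure.le_map_apply (YBWalk.measurable_of_top _).aemeasurable _)
  exact Set.preimage_mono fun c hc => (CurveClass.mem_rangeSubset.1 hc).trans subset_closure

/-- The rescaled midpoint of every mid-edge crossed by the walk is a vertex of the drawn polyline,
hence on its range. [folklore] -/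
theorem mul_planeMidpoint_mem_range_path (γ : YangBaxterSAW Θ Ω δ a b) {e : MidEdge}
    (he : e ∈ γ.mids) : (δ : ℂ) * planeMidpoint Θ e ∈ Set.range (γ.path Θ δ) :=
  mem_range_polyline (List.mem_map_of_mem he)

/-- **A visited rhombus is `2δ`-close to the drawn walk.** If the drawn range of a walk of `Ω_δ` lies
in `Ω''` (`δ ≥ 0`), every rhombus it visits belongs to `(Ω ∩ cthickening (2δ) Ω'')_δ`. [folklore] -/
theorem mem_meshFaces_inter_cthickening_of_range_subset (hδ : 0 ≤ δ) (γ : YangBaxterSAW Θ Ω δ a b)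
    {Ω'' : Set ℂ} (hγ : Set.range (γ.path Θ δ) ⊆ Ω'') {f : Face} (hf : f ∈ γ.facesVisited) :
    f ∈ meshFaces Θ (Ω ∩ Metric.cthickening (2 * δ) Ω'') δ := by
  intro z hz
  refine ⟨γ.mem_of_mem_facesVisited hf z hz, ?_⟩
  obtain ⟨p, hp, hpf⟩ : ∃ p ∈ γ.arcs, arcFace p = some f := by
    simpa [YBWalk.facesVisited, List.mem_filterMap] using hf
  have hm : planeMidpoint Θ p.1 ∈ rhombus Θ f := (planeMidpoint_mem_rhombus_of_arcFace Θ hpf).1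
  have h1 : p.1 ∈ γ.mids := (List.of_mem_zip hp).1
  have hvert : (δ : ℂ) * planeMidpoint Θ p.1 ∈ Ω'' := hγ (mul_planeMidpoint_mem_range_path γ h1)
  refine Metric.mem_cthickening_of_dist_le _ _ _ _ hvert ?_
  rw [dist_eq_norm, ← mul_sub, norm_mul, Complex.norm_real, Real.norm_of_nonneg hδ, mul_comm]
  refine mul_le_mul_of_nonneg_right ?_ hδ
  rw [← dist_eq_norm]
  exact Cruxes.HexTransfer.YbRelay.dist_le_two_of_mem_rhombus Θ f hz hm

/-- **Upper half of the sandwich (event level).** For `δ ≥ 0` and any `Ω''`,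
`{range ⊆ Ω''} ⊆ {γ ⊆ (Ω ∩ cthickening (2δ) Ω'')_δ}`. [folklore] -/
theorem preimage_rangeSubset_subset_setOf_facesVisited (hδ : 0 ≤ δ) (Ω'' : Set ℂ) :
    (fun γ : YangBaxterSAW Θ Ω δ a b => γ.curve Θ δ) ⁻¹' CurveClass.rangeSubset Ω'' ⊆
      {γ | ∀ f ∈ γ.facesVisited, f ∈ meshFaces Θ (Ω ∩ Metric.cthickening (2 * δ) Ω'') δ} := by
  intro γ hγ f hf
  refine mem_meshFaces_inter_cthickening_of_range_subset hδ γ ?_ hf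
  simp only [Set.mem_preimage, YBWalk.curve, CurveClass.mk_mem_rangeSubset] at hγ
  rintro _ ⟨t, rfl⟩
  exact hγ t

/-- **Upper half of the sandwich.** For `δ ≥ 0` and any `Ω''`,
`P_{Ω,δ}(range ⊆ Ω'') ≤ Z((Ω ∩ cthickening (2δ) Ω'')_δ; a, b) / Z(Ω_δ; a, b)`. [folklore] -/
theorem ybLaw_preimage_rangeSubset_le_div (hδ : 0 ≤ δ) (x : ℝ) (Ω'' : Set ℂ) :
    ybLaw Θ Ω δ x a b ((fun γ => γ.curve Θ δ) ⁻¹' CurveClass.rangeSubset Ω'') ≤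
      ybWeight Θ (Ω ∩ Metric.cthickening (2 * δ) Ω'') δ x a b Set.univ /
        ybWeight Θ Ω δ x a b Set.univ := by
  rw [← ybLaw_setOf_facesVisited Set.inter_subset_left x]
  exact measure_mono (preimage_rangeSubset_subset_setOf_facesVisited hδ Ω'')

/-- Upper half of the sandwich for the PUSHED-FORWARD law and the CLOSED event of stub I1: for
`δ ≥ 0`, `(P_{Ω,δ} ∘ curve⁻¹)(range ⊆ closure Ω') ≤ Z((Ω ∩ cthickening (2δ) Ω')_δ)/Z(Ω_δ)`
(`cthickening (2δ) (closure Ω') = cthickening (2δ) Ω'`). [folklore] -/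
theorem map_ybLaw_rangeSubset_closure_le_div (hδ : 0 ≤ δ) (x : ℝ) (Ω' : Set ℂ) :
    (ybLaw Θ Ω δ x a b).map (fun γ => γ.curve Θ δ) (CurveClass.rangeSubset (closure Ω')) ≤
      ybWeight Θ (Ω ∩ Metric.cthickening (2 * δ) Ω') δ x a b Set.univ /
        ybWeight Θ Ω δ x a b Set.univ := by
  rw [Measure.map_apply (YBWalk.measurable_of_top _)
    (CurveClass.measurableSet_rangeSubset isClosed_closure), ← Metric.cthickening_closure]
  exact ybLaw_preimage_rangeSubset_le_div hδ x (closure Ω')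

/-- **The sandwich for the event of stub I1, two-point-function form** (`x = 1`, `δ ≥ 0`, `a ≠ b`,
`Ω' ⊆ Ω`): `G_{Ω'_δ}(a,b)/G_{Ω_δ}(a,b) ≤ (P^{YB}_{Ω,δ} ∘ curve⁻¹)(range ⊆ closure Ω') ≤
G_{(Ω ∩ cthickening (2δ) Ω')_δ}(a,b)/G_{Ω_δ}(a,b)`. [folklore] -/
theorem map_ybLaw_rangeSubset_closure_mem_Icc (h : Ω' ⊆ Ω) (hδ : 0 ≤ δ) (hab : a ≠ b) :
    (ybLaw Θ Ω δ 1 a b).map (fun γ => γ.curve Θ δ) (CurveClass.rangeSubset (closure Ω')) ∈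
      Set.Icc (twoPoint (meshFaces Θ Ω' δ) Θ a b / twoPoint (meshFaces Θ Ω δ) Θ a b)
        (twoPoint (meshFaces Θ (Ω ∩ Metric.cthickening (2 * δ) Ω') δ) Θ a b /
          twoPoint (meshFaces Θ Ω δ) Θ a b) := by
  refine ⟨?_, ?_⟩
  · have := div_le_map_ybLaw_rangeSubset_closure (Θ := Θ) (δ := δ) h hab 1
    rwa [ybWeight_univ_one, ybWeight_univ_one] at this
  · have := map_ybLaw_rangeSubset_closure_le_div (Θ := Θ) (Ω := Ω) (a := a) (b := b) hδ 1 Ω'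
    rwa [ybWeight_univ_one, ybWeight_univ_one] at this

/-- **Registered piece `stub_ybRestrictionSandwich` of the `CompassSLE` skeleton (the LATTICE half of
stub I1, closed form).** For every angle sequence `Θ`, domains `Ω' ⊆ Ω`, mesh `δ ≥ 0` and mid-edges
`a ≠ b`, the pushed-forward critical Yang–Baxter law of `Ω_δ` gives the closed event
`{range ⊆ closure Ω'}` a probability between `G_{Ω'_δ}(a,b)/G_{Ω_δ}(a,b)` and
`G_{(Ω ∩ cthickening (2δ) Ω')_δ}(a,b)/G_{Ω_δ}(a,b)`: the `5/8` restriction law I1 is a statement about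
ratios of Glazman–Manolescu two-point functions of shrinking domains. [folklore] -/
theorem stub_ybRestrictionSandwich :
    ∀ (Θ : ℤ → ℝ) (Ω Ω' : Set ℂ) (δ : ℝ) (a b : MidEdge), Ω' ⊆ Ω → 0 ≤ δ → a ≠ b →
      ((ybLaw Θ Ω δ 1 a b).map (fun γ => γ.curve Θ δ)) (CurveClass.rangeSubset (closure Ω')) ∈
        Set.Icc (twoPoint (meshFaces Θ Ω' δ) Θ a b / twoPoint (meshFaces Θ Ω δ) Θ a b)
          (twoPoint (meshFaces Θ (Ω ∩ Metric.cthickening (2 * δ) Ω') δ) Θ a b /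
            twoPoint (meshFaces Θ Ω δ) Θ a b) :=
  fun _ _ _ _ _ _ h hδ hab => map_ybLaw_rangeSubset_closure_mem_Icc h hδ hab

end Summit.CriticalPhenomena.SAWScalingLimit.Theorems.SAWCompassLatticeCompassSLE

end
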